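import Literature.NumberTheory.EllipticCurves.IwasawaTwistModPTowerExact
import Literature.NumberTheory.EllipticCurves.IwasawaTwistModPTowerTopConst
import HarnessLib

/-!
# The `T`-adic tower of the mod-`(p, T^J)` Iwasawa twists, IV: the multi-step `T^{J−J'}`-embeddings
# `H¹(K, 𝒯_{J'}) → H¹(K, 𝒯_J)` are injective and their image is the `T^{J'}`-torsion when `M^{Γ_K} = 0`;
# every class with `T^{J'} c ≠ 0` has an avatar of level exactly `J'+1` (proofs only; no definition, no fact)

Topic `NumberTheory/EllipticCurves` (sequel of `IwasawaTwistModPTowerExact` / `…TopConst`); namespace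
`Literature.NumberTheory.EllipticCurves.ZpExtension`.  Cell `bsd-smallim` (rung K6 of `BirchSwinnertonDyer`,
crux `MuTransferX9` = item 19276), seat `bsd-smallim-k6-c2` (gen 3), toward the registered stub
`stub_selmerDualOdd` of skeleton v6 (MU-TRANSFER-PROOF §5 STEP 1, Selmer side: "`c' := T^{b−J} c` has exact
order `J`; as `𝒯^∨` is `T`-divisible with `H⁰(G_S, 𝒯^∨) = 0`, `H¹(G_S, 𝒯_J^*) ⥲ H¹(G_S, 𝒯^∨)[T^J]`; let
`y ↦ c'`").  In the finite-level currency `κ.twistModP ρ hM J` of the tree this reads: for a class `Y` of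
`H¹(K, 𝒯_L)` with `T^{J'} Y ≠ 0` there is a class `Ψ` of `H¹(K, 𝒯_{J'+1})` with `T^{J'} Ψ ≠ 0` whose
`T^{L−J'−1}`-embedding is `T^k Y` for some `k`.

* `shiftEmbed_shiftEmbed` — `T^{J₃−J₂} · T^{J₂−J₁} = T^{J₃−J₁}` on coordinates; on `H¹`:
  `map_shiftEmbed_map_shiftEmbed`; `map_shiftEmbed_refl` (the level-`J ≤ J` embedding is the identity).
* `map_shiftEmbed_injective` — **`T^{J−J'}· : H¹(K, 𝒯_{J'}) → H¹(K, 𝒯_J)` is injective when `M^{Γ_K} = 0`**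
  (iterate of the tree's one-step `shiftEmbedH1_injective`).
* `shiftH1_iterate_map_shiftEmbed` — the embeddings commute with the powers of `T`.
* `map_topCoeff_injective` — `H¹(top) : H¹(K, M) → H¹(K, 𝒯_J)` is injective when `M^{Γ_K} = 0`
  (`top = (T^{J−1}-embedding) ∘ (M ≅ 𝒯_1)`), hence `map_constCoeff_eq_zero_of_shiftH1_iterate_eq_zero`:
  **`T^{J} c = 0` in `H¹(K, 𝒯_{J+1})` forces `H¹(mod T)(c) = 0`** (with the tree's `T^{J} = top ∘ const`).
* `exists_map_shiftEmbed_eq_of_shiftH1_iterate_eq_zero` — **a class of `H¹(K, 𝒯_J)` killed by `T^{J'}`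
  (`J' ≤ J`) is the `T^{J−J'}`-embedding of a class of `H¹(K, 𝒯_{J'})`** (induction on the tree's
  one-step exactness `exists_shiftEmbedH1_eq_of_constCoeffH1_eq_zero`).
* `exists_level_class_of_shiftH1_iterate_ne_zero` — the avatar of exact level: `T^{J'} Y ≠ 0` in
  `H¹(K, 𝒯_L)` (`J'+1 ≤ L`) ⟹ `∃ k Ψ`, `Ψ ∈ H¹(K, 𝒯_{J'+1})`, `T^{J'} Ψ ≠ 0`, embedding of `Ψ` `= T^k Y`.

HONEST FRAMING: theorems only; nothing asserted; BSD is not advanced.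

References: B. Mazur, K. Rubin, *Kolyvagin systems*, Mem. AMS 799 (2004) §5.3 [MazurRubin2004];
L. Washington, *Introduction to Cyclotomic Fields* (1997) §13.1–§13.2 [Washington1997]; J.-P. Serre,
*Galois Cohomology* (1997) I §2.2 [SerreGaloisCohomology1997]; HOME/koly/MU-TRANSFER-PROOF.md §5 STEP 1.
-/

noncomputable section

open scoped ContRepresentation
open Field Function

universe u

namespace Literature.NumberTheory.EllipticCurves

open Literature.NumberTheory.GaloisRepresentations

namespace ZpExtension

variable {K : Type u} [Field K] {p : ℕ} [Fact p.Prime] (κ : ZpExtension K p)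
  {M : Type u} [AddCommGroup M] [TopologicalSpace M] [DiscreteTopology M]
  (ρ : DiscreteGaloisModule K M) (hM : ∀ x : M, p • x = 0)

/-! ## Composition of the `T`-embeddings -/

omit [Fact p.Prime] [TopologicalSpace M] [DiscreteTopology M] in
/-- `T^{J₃−J₂} · (T^{J₂−J₁} · x) = T^{J₃−J₁} · x` on coordinates. [cite: Washington1997, §13.1–§13.2] -/
theorem shiftEmbed_shiftEmbed {J₁ J₂ J₃ : ℕ} (h₁₂ : J₁ ≤ J₂) (h₂₃ : J₂ ≤ J₃) (x : Fin J₁ → M) :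
    shiftEmbed J₃ h₂₃ (shiftEmbed J₂ h₁₂ x) = shiftEmbed J₃ (h₁₂.trans h₂₃) x := by
  funext i
  simp only [shiftEmbed_apply]
  by_cases h : J₃ - J₂ ≤ (i : ℕ)
  · rw [dif_pos h]
    by_cases h' : J₂ - J₁ ≤ (i : ℕ) - (J₃ - J₂)
    · rw [dif_pos h', dif_pos (by omega)]
      congr 1
      ext
      simp only
      omega
    · rw [dif_neg h', dif_neg (by omega)]
  · rw [dif_neg h, dif_neg (by omega)]

omit [Fact p.Prime] [TopologicalSpace M] [DiscreteTopology M] in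
/-- The `T^0`-embedding `𝒯_J → 𝒯_J` is the identity. [cite: Washington1997, §13.1–§13.2] -/
theorem shiftEmbed_refl {J : ℕ} (x : Fin J → M) : shiftEmbed J le_rfl x = x := by
  funext i
  rw [shiftEmbed_apply, dif_pos (by omega)]
  congr 1
  ext
  simp

/-- On `H¹`: `H¹(T^{J₃−J₂}·) ∘ H¹(T^{J₂−J₁}·) = H¹(T^{J₃−J₁}·)`. [cite: SerreGaloisCohomology1997, I §2.2] -/
theorem map_shiftEmbed_map_shiftEmbed {J₁ J₂ J₃ : ℕ} (h₁₂ : J₁ ≤ J₂) (h₂₃ : J₂ ≤ J₃)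
    (c : galoisCohomology (κ.twistModP ρ hM J₁) 1) :
    galoisCohomology.map (κ.twistModPShiftEmbed ρ hM J₃ h₂₃) 1
        (galoisCohomology.map (κ.twistModPShiftEmbed ρ hM J₂ h₁₂) 1 c) =
      galoisCohomology.map (κ.twistModPShiftEmbed ρ hM J₃ (h₁₂.trans h₂₃)) 1 c :=
  κ.map_map_twist ρ hM J₁ _ _ _ (fun x => (shiftEmbed_shiftEmbed h₁₂ h₂₃ x).symm) c

/-- On `H¹`, the level-`J ≤ J` embedding is the identity. [cite: SerreGaloisCohomology1997, I §2.2] -/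
theorem map_shiftEmbed_refl {J : ℕ} (c : galoisCohomology (κ.twistModP ρ hM J) 1) :
    galoisCohomology.map (κ.twistModPShiftEmbed ρ hM J le_rfl) 1 c = c := by
  obtain ⟨φ, rfl⟩ := oneCocycleClass_surjective _ c
  rw [map_oneCocycleClass_twist]
  exact congrArg _ (Subtype.ext (ContinuousMap.ext fun σ => shiftEmbed_refl (φ.1 σ)))

/-- **`T^{J−J'}· : H¹(K, 𝒯_{J'}) → H¹(K, 𝒯_J)` is injective when `M^{Γ_K} = 0`** (composite of the
one-step injections `shiftEmbedH1_injective`). [cite: SerreGaloisCohomology1997, I §2.2] -/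
theorem map_shiftEmbed_injective (hinv : ∀ m : M, (∀ σ : absoluteGaloisGroup K, ρ σ m = m) → m = 0)
    {J' J : ℕ} (h : J' ≤ J) :
    Injective (galoisCohomology.map (κ.twistModPShiftEmbed ρ hM J h) 1) := by
  obtain ⟨d, rfl⟩ := Nat.exists_eq_add_of_le h
  induction d with
  | zero =>
    intro a b hab
    rwa [map_shiftEmbed_refl, map_shiftEmbed_refl] at hab
  | succ d ih =>
    have hfac : ∀ c, galoisCohomology.map (κ.twistModPShiftEmbed ρ hM (J' + (d + 1)) h) 1 c =
        galoisCohomology.map (κ.twistModPShiftEmbed ρ hM (J' + d + 1) (Nat.le_succ _)) 1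
          (galoisCohomology.map (κ.twistModPShiftEmbed ρ hM (J' + d) (Nat.le_add_right J' d)) 1 c) :=
      fun c => (κ.map_shiftEmbed_map_shiftEmbed ρ hM (Nat.le_add_right J' d) (Nat.le_succ _) c).symm
    intro a b hab
    rw [hfac, hfac] at hab
    exact ih (Nat.le_add_right J' d) (κ.shiftEmbedH1_injective ρ hM (J' + d) hinv hab)

/-! ## The embeddings commute with `T` -/

/-- `T ∘ H¹(T^{J−J'}·) = H¹(T^{J−J'}·) ∘ T`. [cite: Washington1997, §13.1–§13.2] -/
theorem shiftH1_map_shiftEmbed {J' J : ℕ} (h : J' ≤ J) (c : galoisCohomology (κ.twistModP ρ hM J') 1) :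
    κ.shiftH1 ρ hM J (galoisCohomology.map (κ.twistModPShiftEmbed ρ hM J h) 1 c) =
      galoisCohomology.map (κ.twistModPShiftEmbed ρ hM J h) 1 (κ.shiftH1 ρ hM J' c) := by
  unfold shiftH1
  rw [κ.map_map_twist ρ hM J' _ _ ((κ.twistModPShift ρ hM J).comp (κ.twistModPShiftEmbed ρ hM J h))
      (fun _ => rfl),
    κ.map_map_twist ρ hM J' _ _ ((κ.twistModPShiftEmbed ρ hM J h).comp (κ.twistModPShift ρ hM J'))
      (fun _ => rfl)]
  exact κ.map_eq_map_of_coe_eq ρ hM J' _ _ (fun x => shiftEnd_shiftEmbed J h x) c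

/-- Iterated: `T^[k] ∘ H¹(T^{J−J'}·) = H¹(T^{J−J'}·) ∘ T^[k]`. [cite: Washington1997, §13.1–§13.2] -/
theorem shiftH1_iterate_map_shiftEmbed {J' J : ℕ} (h : J' ≤ J) (k : ℕ)
    (c : galoisCohomology (κ.twistModP ρ hM J') 1) :
    (κ.shiftH1 ρ hM J)^[k] (galoisCohomology.map (κ.twistModPShiftEmbed ρ hM J h) 1 c) =
      galoisCohomology.map (κ.twistModPShiftEmbed ρ hM J h) 1 ((κ.shiftH1 ρ hM J')^[k] c) := by
  induction k generalizing c with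
  | zero => rfl
  | succ k ih => rw [iterate_succ_apply, iterate_succ_apply, ← ih, shiftH1_map_shiftEmbed]

/-- `T^[k] 0 = 0`. [cite: Washington1997, §13.1–§13.2] -/
theorem shiftH1_iterate_zero {J : ℕ} (k : ℕ) :
    (κ.shiftH1 ρ hM J)^[k] (0 : galoisCohomology (κ.twistModP ρ hM J) 1) = 0 := by
  induction k with
  | zero => rfl
  | succ k ih => rw [iterate_succ_apply', ih, map_zero]

/-- `T^[a + b] = T^[b] ∘ T^[a]` with zero propagation: `T^[a] c = 0 ⟹ T^[a + b] c = 0`.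
[cite: Washington1997, §13.1–§13.2] -/
theorem shiftH1_iterate_eq_zero_of_le {J a b : ℕ} (hab : a ≤ b) (c : galoisCohomology (κ.twistModP ρ hM J) 1)
    (hc : (κ.shiftH1 ρ hM J)^[a] c = 0) : (κ.shiftH1 ρ hM J)^[b] c = 0 := by
  obtain ⟨d, rfl⟩ := Nat.exists_eq_add_of_le hab
  rw [add_comm, iterate_add_apply, hc, shiftH1_iterate_zero]

/-! ## `H¹(top)` is injective; `T^J c = 0` forces `H¹(mod T)(c) = 0` -/

omit [Fact p.Prime] [TopologicalSpace M] [DiscreteTopology M] in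
/-- `top_J = T^{J−1}· ∘ top_1` on coordinates (`top_1 : M ≅ 𝒯_1`). [cite: Washington1997, §13.1–§13.2] -/
theorem single_top_eq_shiftEmbed_single {J : ℕ} (hJ : 0 < J) (m : M) :
    (Pi.single (⟨J - 1, Nat.sub_lt hJ Nat.one_pos⟩ : Fin J) m : Fin J → M) =
      shiftEmbed J (Nat.succ_le_of_lt hJ) (Pi.single (⟨0, Nat.one_pos⟩ : Fin 1) m) := by
  funext i
  rw [shiftEmbed_apply, Pi.single_apply]
  by_cases h : J - 1 ≤ (i : ℕ)
  · rw [dif_pos h]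
    have hi : i = ⟨J - 1, Nat.sub_lt hJ Nat.one_pos⟩ := Fin.ext (by simp; omega)
    rw [if_pos hi, Pi.single_apply, if_pos (Fin.ext (by simp [hi]))]
  · rw [dif_neg h, if_neg]
    intro hi
    apply h
    rw [hi]

/-- **`H¹(top) : H¹(K, M) → H¹(K, 𝒯_J)` is injective when `M^{Γ_K} = 0`**: `top_J = (T^{J−1}-embedding) ∘
top_1` with `top_1 : M ≅ 𝒯_1` (inverse `const_1`). [cite: SerreGaloisCohomology1997, I §2.2] -/
theorem map_topCoeff_injective (hinv : ∀ m : M, (∀ σ : absoluteGaloisGroup K, ρ σ m = m) → m = 0)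
    {J : ℕ} (hJ : 0 < J) :
    Injective (galoisCohomology.map (κ.twistModPTopCoeff ρ hM J hJ) 1) := by
  have hfac : ∀ c : galoisCohomology ρ 1, galoisCohomology.map (κ.twistModPTopCoeff ρ hM J hJ) 1 c =
      galoisCohomology.map (κ.twistModPShiftEmbed ρ hM J (Nat.succ_le_of_lt hJ)) 1
        (galoisCohomology.map (κ.twistModPTopCoeff ρ hM 1 Nat.one_pos) 1 c) := by
    intro c
    obtain ⟨φ, rfl⟩ := oneCocycleClass_surjective _ c
    unfold galoisCohomology.map
    change ContinuousCohomology.map _ _ 1 (oneCocycleClass ρ.toTopRep φ) =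
      ContinuousCohomology.map _ _ 1 (ContinuousCohomology.map _ _ 1 (oneCocycleClass ρ.toTopRep φ))
    rw [map_oneCocycleClass, map_oneCocycleClass, map_oneCocycleClass]
    refine congrArg _ (Subtype.ext (ContinuousMap.ext fun σ => ?_))
    exact single_top_eq_shiftEmbed_single hJ (φ.1 σ)
  have hleft : ∀ c : galoisCohomology ρ 1,
      galoisCohomology.map (κ.twistModPConstCoeff ρ hM 1 Nat.one_pos) 1
        (galoisCohomology.map (κ.twistModPTopCoeff ρ hM 1 Nat.one_pos) 1 c) = c := by
    intro c
    obtain ⟨φ, rfl⟩ := oneCocycleClass_surjective _ c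
    unfold galoisCohomology.map
    change ContinuousCohomology.map _ _ 1 (ContinuousCohomology.map _ _ 1 (oneCocycleClass ρ.toTopRep φ)) =
      oneCocycleClass ρ.toTopRep φ
    rw [map_oneCocycleClass, map_oneCocycleClass]
    refine congrArg _ (Subtype.ext (ContinuousMap.ext fun σ => ?_))
    change (Pi.single (⟨0, Nat.one_pos⟩ : Fin 1) (φ.1 σ) : Fin 1 → M) ⟨0, Nat.one_pos⟩ = φ.1 σ
    simp
  intro a b hab
  rw [hfac, hfac] at hab
  have h1 := κ.map_shiftEmbed_injective ρ hM hinv (Nat.succ_le_of_lt hJ) hab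
  have h2 := congrArg (galoisCohomology.map (κ.twistModPConstCoeff ρ hM 1 Nat.one_pos) 1) h1
  rwa [hleft, hleft] at h2

/-- **`T^{J} c = 0` in `H¹(K, 𝒯_{J+1})` forces `H¹(mod T)(c) = 0`** when `M^{Γ_K} = 0`
(`T^{J} = H¹(top) ∘ H¹(const)` and `H¹(top)` is injective). [cite: SerreGaloisCohomology1997, I §2.2]
[cite: MazurRubin2004, §5.3] -/
theorem map_constCoeff_eq_zero_of_shiftH1_iterate_eq_zero
    (hinv : ∀ m : M, (∀ σ : absoluteGaloisGroup K, ρ σ m = m) → m = 0) {J : ℕ}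
    (c : galoisCohomology (κ.twistModP ρ hM (J + 1)) 1) (hc : (κ.shiftH1 ρ hM (J + 1))^[J] c = 0) :
    galoisCohomology.map (κ.twistModPConstCoeff ρ hM (J + 1) (Nat.succ_pos J)) 1 c = 0 := by
  have h := κ.shiftH1_iterate_pred_eq_map_top_map_const ρ hM (Nat.succ_pos J) c
  rw [Nat.succ_sub_one, hc] at h
  exact κ.map_topCoeff_injective ρ hM hinv (Nat.succ_pos J) (by rw [← h, map_zero])

/-! ## The image of the embeddings is the `T^{J'}`-torsion; avatars of exact level -/

/-- **A class of `H¹(K, 𝒯_J)` killed by `T^{J'}` (`J' ≤ J`) is the `T^{J−J'}`-embedding of a class of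
`H¹(K, 𝒯_{J'})`** when `M^{Γ_K} = 0` — the finite-level form of "`H¹(G_S, 𝒯_{J'}^*) ⥲ H¹(G_S, 𝒯^∨)[T^{J'}]`"
(MU-TRANSFER-PROOF §5 STEP 1). [cite: MazurRubin2004, §5.3] [cite: SerreGaloisCohomology1997, I §2.2] -/
theorem exists_map_shiftEmbed_eq_of_shiftH1_iterate_eq_zero
    (hinv : ∀ m : M, (∀ σ : absoluteGaloisGroup K, ρ σ m = m) → m = 0) {J' J : ℕ} (h : J' ≤ J)
    (c : galoisCohomology (κ.twistModP ρ hM J) 1) (hc : (κ.shiftH1 ρ hM J)^[J'] c = 0) :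
    ∃ x : galoisCohomology (κ.twistModP ρ hM J') 1,
      galoisCohomology.map (κ.twistModPShiftEmbed ρ hM J h) 1 x = c := by
  obtain ⟨d, rfl⟩ := Nat.exists_eq_add_of_le h
  induction d with
  | zero => exact ⟨c, κ.map_shiftEmbed_refl ρ hM c⟩
  | succ d ih =>
    -- `T^{J'+d} c = 0`, so `c mod T = 0` and `c = T · c₁`
    have hc' : (κ.shiftH1 ρ hM (J' + d + 1))^[J' + d] c = 0 :=
      κ.shiftH1_iterate_eq_zero_of_le ρ hM (Nat.le_add_right J' d) c hc
    have h0 := κ.map_constCoeff_eq_zero_of_shiftH1_iterate_eq_zero ρ hM hinv c hc'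
    obtain ⟨c₁, hc₁⟩ := κ.exists_shiftEmbedH1_eq_of_constCoeffH1_eq_zero ρ hM (J' + d) c h0
    -- `T^{J'} c₁ = 0` by injectivity of the one-step embedding
    have hc₁T : (κ.shiftH1 ρ hM (J' + d))^[J'] c₁ = 0 := by
      apply κ.shiftEmbedH1_injective ρ hM (J' + d) hinv
      rw [map_zero, ← κ.shiftH1_iterate_map_shiftEmbed ρ hM (Nat.le_succ _) J' c₁, hc₁]
      exact hc
    obtain ⟨x, hx⟩ := ih (Nat.le_add_right J' d) c₁ hc₁T
    refine ⟨x, ?_⟩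
    show galoisCohomology.map (κ.twistModPShiftEmbed ρ hM (J' + d + 1)
      ((Nat.le_add_right J' d).trans (Nat.le_succ _))) 1 x = c
    rw [← κ.map_shiftEmbed_map_shiftEmbed ρ hM (Nat.le_add_right J' d) (Nat.le_succ _) x, hx, hc₁]

/-- **Avatar of exact level.**  If `Y ∈ H¹(K, 𝒯_L)` has `T^{J'} Y ≠ 0` and `J' + 1 ≤ L` (with `M^{Γ_K} = 0`),
then for some `k` and some `Ψ ∈ H¹(K, 𝒯_{J'+1})` with `T^{J'} Ψ ≠ 0`, the `T^{L−J'−1}`-embedding of `Ψ` is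
`T^k Y` (`k + J' + 1` = the `T`-order of `Y`).  MU-TRANSFER-PROOF §5 STEP 1: `c' = T^{b−J} c` of exact
order `J` and its lift `y`. [cite: MazurRubin2004, §5.3] [cite: SerreGaloisCohomology1997, I §2.2] -/
theorem exists_level_class_of_shiftH1_iterate_ne_zero
    (hinv : ∀ m : M, (∀ σ : absoluteGaloisGroup K, ρ σ m = m) → m = 0) {J' L : ℕ} (h : J' + 1 ≤ L)
    (Y : galoisCohomology (κ.twistModP ρ hM L) 1) (hY : (κ.shiftH1 ρ hM L)^[J'] Y ≠ 0) :
    ∃ (k : ℕ) (Ψ : galoisCohomology (κ.twistModP ρ hM (J' + 1)) 1),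
      (κ.shiftH1 ρ hM (J' + 1))^[J'] Ψ ≠ 0 ∧
      galoisCohomology.map (κ.twistModPShiftEmbed ρ hM L h) 1 Ψ = (κ.shiftH1 ρ hM L)^[k] Y := by
  classical
  -- the `T`-order `m` of `Y`: least `m` with `T^m Y = 0` (exists: `T^L = 0`)
  have hex : ∃ m : ℕ, (κ.shiftH1 ρ hM L)^[m] Y = 0 := ⟨L, κ.shiftH1_iterate_eq_zero ρ hM L le_rfl Y⟩
  set m := Nat.find hex with hmdef
  have hm : (κ.shiftH1 ρ hM L)^[m] Y = 0 := Nat.find_spec hex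
  have hJm : J' + 1 ≤ m := by
    by_contra hlt
    exact hY (κ.shiftH1_iterate_eq_zero_of_le ρ hM (by omega) Y hm)
  -- `Y' := T^{m−J'−1} Y` has `T^{J'+1} Y' = 0` and `T^{J'} Y' = T^{m−1} Y ≠ 0`
  set Y' := (κ.shiftH1 ρ hM L)^[m - (J' + 1)] Y with hY'def
  have hY'0 : (κ.shiftH1 ρ hM L)^[J' + 1] Y' = 0 := by
    rw [hY'def, ← iterate_add_apply, show J' + 1 + (m - (J' + 1)) = m by omega, hm]
  have hY'1 : (κ.shiftH1 ρ hM L)^[J'] Y' ≠ 0 := by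
    rw [hY'def, ← iterate_add_apply, show J' + (m - (J' + 1)) = m - 1 by omega]
    have := Nat.find_min hex (show m - 1 < m by omega)
    exact this
  obtain ⟨Ψ, hΨ⟩ := κ.exists_map_shiftEmbed_eq_of_shiftH1_iterate_eq_zero ρ hM hinv h Y' hY'0
  refine ⟨m - (J' + 1), Ψ, fun h0 => hY'1 ?_, hΨ⟩
  rw [← hΨ, κ.shiftH1_iterate_map_shiftEmbed ρ hM h J' Ψ, h0, map_zero]

end ZpExtension

end Literature.NumberTheory.EllipticCurves

end
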